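import Summits.CriticalPhenomena.PercolationContinuityZ3.Theorems.PercNearOneGluingNoHeavyLowerTailWorstRelayGluing
import HarnessLib

/-!
# `NoHeavyLowerTail` (stmt-CriticalPhenomena-4575) — CONDITIONAL GLUING `COND_k` (= Kozma–Nitzan's post-FKG Conjecture 1 in joint form):
# reductions and the rung `|A| ≤ 2`

Support file (prover prim-ineq-prove-1, new-inequality factory, prove seat; `--supports stmt-CriticalPhenomena-4575`).
No definitions, no named facts, no sorries.

Setting: `μ = prodBernoulli w` on `Fin n`, observer `o`, sink `c`, finite relay set `A`, `{o ↔ A} := ⋃_{a∈A} {o ↔ a}`,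
`d_a := μ(a ↮ c)`.

CONDITIONAL GLUING (the factory target `TGT-COND3` at `|A| = 3`; kcluster's `(U_min)`):
   `COND_k :  μ({o ↮ c} ∩ {o ↔ A}) ≤ μ(o ↔ A) · max_{a∈A} d_a`,   i.e.  `μ(o ↮ c | o ↔ A) ≤ max_a μ(a ↮ c)`:
given that the observer reaches the relay set, it fails to reach the sink no more often than the worst relay does.
It is Kozma–Nitzan's CONJECTURE 1 (post-FKG; arXiv:2401.12397 p. 3, `P(o ↔ c) ≥ P(o ↔ A)·min_a P(a ↔ c)`, tree
`Literature.StrongHypotheses.CriticalPhenomena.KozmaNitzan2024_conjecture1`) in the formally stronger JOINT form (left side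
`μ({o ↔ c} ∩ {o ↔ A})`); it sits between worst-relay gluing `(U₁)` (= KN Question 7, `Theorems.WorstRelayGluing`) and sharp event gluing:
   `(U₁)` + Harris ⟹ `COND_k` ⟹ event gluing with constant `1`  (`μ({o ↮ c} ∩ {o ↔ A}) ≤ max_a d_a`) ⟹ the crux (landed glue).
At `k = 3` the LP lane separates them: `(U₁)₃` has an exact pseudo-law surviving every proved row family (ttrl gz RESULT 1b), `COND₃` is
not cut by those vectors (harness TGT-COND3) — it is the weakest three-relay statement of k-uniform meaning, open in print at `|A| = 3`.

This file (scaffolding for the `|A| = 3` certificate; everything here is proved):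
* `condGluing_of_worstRelayGluing_at` — on ONE instance, `(U₁)` at a worst relay ⟹ `COND` (Harris, increasing × decreasing);
* `condGluing_card_le_two` — `COND_k` for `|A| ≤ 2` (from the landed `worstRelayGluing_card_le_two`);
* `kozmaNitzan_conjecture1_of_condGluing_at` — on one instance, `COND` ⟹ KN's Conjecture-1 inequality
  `μ(o ↔ A)·t ≤ μ(o ↔ c)` whenever `t ≤ μ(a ↔ c)` on `A`;
* `kozmaNitzan_conjecture1_card_le_two` — KOZMA–NITZAN'S CONJECTURE 1 FOR `|A| ≤ 2`, every finite weighted graph (KN prove the pre-FKG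
  form for `|A| = 2`, Thm 1; this is its post-FKG corollary, stated for the registered conjecture's signature restricted to `A.card ≤ 2`);
* `eventGluing_of_condGluing_at` — `COND` ⟹ event gluing with constant `1` on the instance.
[cite: KozmaNitzan2024, Conjecture 1 (p. 3), Theorem 1 (p. 7)]
-/

noncomputable section

namespace Summit.CriticalPhenomena.PercolationContinuityZ3.Theorems

open MeasureTheory Set Literature.Probability.LatticeModels Literature.Probability.Percolation
open scoped Classical BigOperators

namespace CondGluing

variable {n : ℕ}

/-- **`(U₁)` at a worst relay ⟹ conditional gluing, on one instance.**  If `μ({o↮c} ∩ {o↔A}) ≤ μ({a₁↮c} ∩ {o↔A})` then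
`μ({o↮c} ∩ {o↔A}) ≤ μ(o↔A) · μ(a₁↮c)` — Harris for the increasing `{o ↔ A}` and the decreasing `{a₁ ↮ c}`.
[cite: KozmaNitzan2024, p. 3 (Conjecture 1 follows from Conjecture 2 by FKG)] -/
theorem condGluing_of_worstRelayGluing_at (w : Sym2 (Fin n) → unitInterval) (A : Finset (Fin n)) (o c a₁ : Fin n)
    (hU1 : (prodBernoulli w).real ((openConn o c : Set (BondConfig (Fin n)))ᶜ ∩ ⋃ a ∈ A, openConn o a) ≤
      (prodBernoulli w).real ((openConn a₁ c : Set (BondConfig (Fin n)))ᶜ ∩ ⋃ a ∈ A, openConn o a)) :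
    (prodBernoulli w).real ((openConn o c : Set (BondConfig (Fin n)))ᶜ ∩ ⋃ a ∈ A, openConn o a) ≤
      (prodBernoulli w).real (⋃ a ∈ A, (openConn o a : Set (BondConfig (Fin n)))) *
        (prodBernoulli w).real (openConn a₁ c : Set (BondConfig (Fin n)))ᶜ := by
  set U : Set (BondConfig (Fin n)) := ⋃ a ∈ A, (openConn o a : Set (BondConfig (Fin n))) with hU
  have hUup : IsUpperSet U := isUpperSet_iUnion₂ fun a _ => isUpperSet_openConn o a
  have hH := prodBernoulli_harris_upper_lower_via_fibres w hUup (isUpperSet_openConn a₁ c).compl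
  have e : ((openConn a₁ c : Set (BondConfig (Fin n)))ᶜ ∩ U) = U ∩ (openConn a₁ c)ᶜ := Set.inter_comm _ _
  rw [e] at hU1
  exact hU1.trans hH

/-- **Conditional gluing for `|A| ≤ 2` (PROVED).**  For every finite weighted graph, observer `o`, sink `c`, relay set `A` with
`A.card ≤ 2` and worst relay `a₁ ∈ A` (`μ(a↮c) ≤ μ(a₁↮c)` on `A`):  `μ({o↮c} ∩ {o↔A}) ≤ μ(o↔A) · μ(a₁↮c)`.
[cite: KozmaNitzan2024, Theorem 1 (p. 7)] -/
theorem condGluing_card_le_two (w : Sym2 (Fin n) → unitInterval) (A : Finset (Fin n)) (o c a₁ : Fin n)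
    (hA : A.card ≤ 2) (ha₁ : a₁ ∈ A)
    (hworst : ∀ a ∈ A, (prodBernoulli w).real (openConn a c : Set (BondConfig (Fin n)))ᶜ ≤
      (prodBernoulli w).real (openConn a₁ c : Set (BondConfig (Fin n)))ᶜ) :
    (prodBernoulli w).real ((openConn o c : Set (BondConfig (Fin n)))ᶜ ∩ ⋃ a ∈ A, openConn o a) ≤
      (prodBernoulli w).real (⋃ a ∈ A, (openConn o a : Set (BondConfig (Fin n)))) *
        (prodBernoulli w).real (openConn a₁ c : Set (BondConfig (Fin n)))ᶜ :=
  condGluing_of_worstRelayGluing_at w A o c a₁ (WorstRelayGluing.worstRelayGluing_card_le_two w A o c a₁ hA ha₁ hworst)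

/-- **Conditional gluing ⟹ Kozma–Nitzan's Conjecture-1 inequality, on one instance.**  If
`μ({o↮c} ∩ {o↔A}) ≤ μ(o↔A) · μ(a₁↮c)` for some `a₁ ∈ A`, then `μ(o↔A) · t ≤ μ(o↔c)` for every `t` with `t ≤ μ(a↔c)` on `A`
(`μ(o↔A) t ≤ μ(o↔A) μ(a₁↔c) = μ(o↔A) − μ(o↔A) μ(a₁↮c) ≤ μ(o↔A) − μ({o↮c} ∩ {o↔A}) = μ({o↔c} ∩ {o↔A}) ≤ μ(o↔c)`).
[cite: KozmaNitzan2024, Conjecture 1 (p. 3)] -/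
theorem kozmaNitzan_conjecture1_of_condGluing_at (w : Sym2 (Fin n) → unitInterval) (A : Finset (Fin n)) (o c a₁ : Fin n)
    (ha₁ : a₁ ∈ A)
    (hcond : (prodBernoulli w).real ((openConn o c : Set (BondConfig (Fin n)))ᶜ ∩ ⋃ a ∈ A, openConn o a) ≤
      (prodBernoulli w).real (⋃ a ∈ A, (openConn o a : Set (BondConfig (Fin n)))) *
        (prodBernoulli w).real (openConn a₁ c : Set (BondConfig (Fin n)))ᶜ)
    (t : ℝ) (ht : ∀ a ∈ A, t ≤ (prodBernoulli w).real (openConn a c)) :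
    (prodBernoulli w).real (⋃ a ∈ A, openConn o a) * t ≤ (prodBernoulli w).real (openConn o c) := by
  haveI : IsProbabilityMeasure (prodBernoulli w) := inferInstance
  set μ := prodBernoulli w with hμ
  set U : Set (BondConfig (Fin n)) := ⋃ a ∈ A, (openConn o a : Set (BondConfig (Fin n))) with hU
  have hsplit := OwnDisconnection.split w U (openConn o c)
  have hd1 : μ.real (openConn a₁ c : Set (BondConfig (Fin n)))ᶜ = 1 - μ.real (openConn a₁ c : Set (BondConfig (Fin n))) :=
    probReal_compl_eq_one_sub MeasurableSet.of_discrete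
  have hta : t ≤ μ.real (openConn a₁ c : Set (BondConfig (Fin n))) := ht a₁ ha₁
  have hUn : 0 ≤ μ.real U := measureReal_nonneg
  have hmono : μ.real (U ∩ openConn o c) ≤ μ.real (openConn o c : Set (BondConfig (Fin n))) :=
    measureReal_mono inter_subset_right
  have e : ((openConn o c : Set (BondConfig (Fin n)))ᶜ ∩ U) = U ∩ (openConn o c)ᶜ := Set.inter_comm _ _
  rw [e] at hcond
  nlinarith [mul_le_mul_of_nonneg_left hta hUn]

/-- **Kozma–Nitzan's Conjecture 1 (post-FKG) for `|A| ≤ 2` (PROVED)**, in the signature of the registered conjecture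
`KozmaNitzan2024_conjecture1` restricted to `A.card ≤ 2`: for every finite weighted graph, `A` with at most two relays, observer
`o`, target `c` and `t` with `t ≤ μ(a ↔ c)` on `A`:  `μ(o ↔ A) · t ≤ μ(o ↔ c)`.  (KN prove the stronger pre-FKG form at `|A| = 2`,
Thm 1; here: `condGluing_card_le_two` at a worst relay + `kozmaNitzan_conjecture1_of_condGluing_at`.)
[cite: KozmaNitzan2024, Conjecture 1 (p. 3), Theorem 1 (p. 7)] -/
theorem kozmaNitzan_conjecture1_card_le_two (w : Sym2 (Fin n) → unitInterval) (A : Finset (Fin n)) (o c : Fin n)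
    (hA : A.card ≤ 2) (t : ℝ) (ht : ∀ a ∈ A, t ≤ (prodBernoulli w).real (openConn a c)) :
    (prodBernoulli w).real (⋃ a ∈ A, openConn o a) * t ≤ (prodBernoulli w).real (openConn o c) := by
  set μ := prodBernoulli w with hμ
  set d : Fin n → ℝ := fun x => μ.real (openConn x c : Set (BondConfig (Fin n)))ᶜ with hd
  rcases A.eq_empty_or_nonempty with hAe | hAne
  · subst hAe
    simp only [Finset.notMem_empty, Set.iUnion_of_empty, Set.iUnion_empty, measureReal_empty, zero_mul]
    exact measureReal_nonneg
  obtain ⟨a₁, ha₁, hmax⟩ := Finset.exists_max_image A d hAne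
  exact kozmaNitzan_conjecture1_of_condGluing_at w A o c a₁ ha₁ (condGluing_card_le_two w A o c a₁ hA ha₁ hmax) t ht

/-- **Conditional gluing ⟹ event gluing with constant `1`, on one instance**: from `μ({o↮c} ∩ {o↔A}) ≤ μ(o↔A)·μ(a₁↮c)` and
`μ(a↮c) ≤ s` for `a = a₁` get `μ({o↮c} ∩ {o↔A}) ≤ s` (since `μ(o↔A) ≤ 1`). [cite: KozmaNitzan2024, Conjecture 1 (p. 3)] -/
theorem eventGluing_of_condGluing_at (w : Sym2 (Fin n) → unitInterval) (A : Finset (Fin n)) (o c a₁ : Fin n)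
    (hcond : (prodBernoulli w).real ((openConn o c : Set (BondConfig (Fin n)))ᶜ ∩ ⋃ a ∈ A, openConn o a) ≤
      (prodBernoulli w).real (⋃ a ∈ A, (openConn o a : Set (BondConfig (Fin n)))) *
        (prodBernoulli w).real (openConn a₁ c : Set (BondConfig (Fin n)))ᶜ)
    (s : ℝ) (hs : (prodBernoulli w).real (openConn a₁ c : Set (BondConfig (Fin n)))ᶜ ≤ s) :
    (prodBernoulli w).real ((openConn o c : Set (BondConfig (Fin n)))ᶜ ∩ ⋃ a ∈ A, openConn o a) ≤ s := by
  haveI : IsProbabilityMeasure (prodBernoulli w) := inferInstance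
  have hU1 : (prodBernoulli w).real (⋃ a ∈ A, (openConn o a : Set (BondConfig (Fin n)))) ≤ 1 := measureReal_le_one
  have hd0 : 0 ≤ (prodBernoulli w).real (openConn a₁ c : Set (BondConfig (Fin n)))ᶜ := measureReal_nonneg
  calc (prodBernoulli w).real ((openConn o c : Set (BondConfig (Fin n)))ᶜ ∩ ⋃ a ∈ A, openConn o a)
      ≤ (prodBernoulli w).real (⋃ a ∈ A, (openConn o a : Set (BondConfig (Fin n)))) *
          (prodBernoulli w).real (openConn a₁ c : Set (BondConfig (Fin n)))ᶜ := hcond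
    _ ≤ 1 * (prodBernoulli w).real (openConn a₁ c : Set (BondConfig (Fin n)))ᶜ := mul_le_mul_of_nonneg_right hU1 hd0
    _ ≤ s := by rw [one_mul]; exact hs

end CondGluing

end Summit.CriticalPhenomena.PercolationContinuityZ3.Theorems

end
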